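import Summits.CriticalPhenomena.SAWScalingLimit.Theorems.SAWDevelopingMapNoFoldBoundDepthTwoPort

/-!
# `NoFoldBound`, line Ideator3Sketch — the source-adjacent stratum of the collar: slit coherence
# at a vertex adjacent to the source vertex, from rigid classes, a loop bound and dominance

Crux `NoFoldBound` (stmt-CriticalPhenomena-8296), route `SAWDevelopingMap`, lead seat c4, skeleton v8.
The depth-2 theorem `depthTwo_core` (DepthTwoPort) treats an interior vertex `v` with a neighbour
`w₀ ∉ a` touching the complement. This file treats the remaining touching position: `w₀ ∈ a`, i.e.
`w₀` IS the source vertex (`a = {x, w₀}`, `x ∉ Λ`, third neighbour `y`). The structure is the same: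

* the port `w₀` carries exactly ONE first arrival, the one-vertex walk `[w₀]`
  (`verts_eq_of_sealed_source`), of winding `W(mid a → c w₀ → mid{w₀,v})` (`winding_of_verts_eq_singleton`);
* the first arrivals at the ports `p ≠ w₀` start `w₀ → y`, avoid `v`, and close up through `v` to a simple
  cycle through the boundary vertex `w₀`; by the loop lemma (discrete Umlaufsatz seen from `x ∉ Λ`) their
  windings are RIGID and explicit — this is the hypothesis `hC` here (registered stub `stub_sourceAdjClasses`
  of the skeleton, proved separately):
  `W(γ) = −5·W(mid a → c w₀ → mid{w₀,y}) − W(mid{p,v} → c v → mid{v,w₀}) − W(mid{v,w₀} → c w₀ → mid{w₀,y})`;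
* hence three consecutive classes with offset `δ₀ = W(w₀) − W(w₁) = (3ε' − 1)π/3`, `ε'` the sign of the
  turn `y → w₀ → v` — IDENTICAL to the depth-2 offset — and the algebra of `depthTwo_core`
  (`dressed_box` from the loop bound `hL`, `three_class_bound_min'` from dominance `hdom`) applies verbatim.

Results: `sourceAdj_core` (source vertex in position `w₀` of a positive labelling, `k = 19/20`) and
`sourceAdj_coherence` (all positions). Nothing unproved is asserted: classes, loop bound and dominance
enter as hypotheses. [folklore assembly]
-/

noncomputable section

open scoped BigOperators
open Literature.Probability.LatticeModels Literature.Probability.RandomPlanarGeometry.SAW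

namespace Summit.CriticalPhenomena.SAWScalingLimit.Theorems.SAWDevelopingMapNoFoldBound

/-! ## The trivial first arrival at the source port -/

/-- The winding of a one-vertex walk `[w]` from `a` to `{v, w}` is the one-step winding
`mid a → c(w) → mid{w, v}`. [folklore] -/
theorem winding_of_verts_eq_singleton {Λ : Finset HexVertex} {a : Sym2 HexVertex} {v w : HexVertex}
    (γ : HexMidEdgeSAW Λ a s(v, w)) (h : γ.verts = [w]) :
    γ.winding = winding [hexMidpoint a, hexCenter w, hexMidpoint s(w, v)] := by
  rw [HexMidEdgeSAW.winding, HexMidEdgeSAW.points, h, Sym2.eq_swap (a := v) (b := w)]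
  rfl

/-! ## The source-adjacent core -/

/-- **Source-adjacent core (source vertex in position `w₀`, positive labelling).** Let `Λ` be simply
connected with source `a = {x, w₀} ∈ ∂Ω` (`x ∉ Λ`, `w₀ ∈ Λ` the source vertex, third neighbour `y` of
`w₀`), `v ∈ Λ` off `a` a neighbour of `w₀` with pairwise distinct neighbours `w₀, w₁, w₂` in the positive
order (turn `w₀ → v → w₁ = +π/3`). Assume the quantitative slit-loop bound `hL` (returning-loop series
`≤ 1/5` in every simply connected domain), the rigid source-adjacent classes `hC` at `v` (every first
arrival at a port `p ≠ w₀` has winding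
`−5·W(mid a → c w₀ → mid{w₀,y}) − W(mid{p,v} → c v → mid{v,w₀}) − W(mid{v,w₀} → c w₀ → mid{w₀,y})`) and
middle-port dominance `hdom` at `v` (if `y → w₀ → v` turns left the dressed sum-mass of `w₁` is at least
the smaller of those of `w₀, w₂`; if it turns right, that of `w₂` is at least the smaller of those of
`w₀, w₁`). Then the slit-coherence inequality holds at `v` with `k = 19/20`. [folklore assembly] -/
theorem sourceAdj_core
    (hL : ∀ (Λ : Finset HexVertex), hexDomainSimplyConnected Λ →
      ∀ u v w₁ w₂ : HexVertex, u ∉ Λ → v ∈ Λ → hexGraph.Adj v u → hexGraph.Adj v w₁ →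
        hexGraph.Adj v w₂ → u ≠ w₁ → u ≠ w₂ → w₁ ≠ w₂ →
        (∑ γ : HexMidEdgeSAW (Λ.erase v) s(v, w₁) s(v, w₂), hexCriticalFugacity ^ γ.length) ≤ 1 / 5)
    {Λ : Finset HexVertex} (hΛ : hexDomainSimplyConnected Λ) {a : Sym2 HexVertex}
    (ha : a ∈ hexDomainBoundary Λ) {v : HexVertex} (hv : v ∈ Λ) (hva : v ∉ a)
    {w₀ w₁ w₂ x y : HexVertex} (h₀ : hexGraph.Adj v w₀) (h₁ : hexGraph.Adj v w₁)
    (h₂ : hexGraph.Adj v w₂) (h₀₁ : w₀ ≠ w₁) (h₁₂ : w₁ ≠ w₂) (h₀₂ : w₀ ≠ w₂) (hw₀ : w₀ ∈ Λ)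
    (hax : a = s(x, w₀))
    (hchir : winding [hexMidpoint s(w₀, v), hexCenter v, hexMidpoint s(v, w₁)] = Real.pi / 3)
    (hwx : hexGraph.Adj w₀ x) (hwy : hexGraph.Adj w₀ y) (hvx : v ≠ x) (hxy : x ≠ y) (hvy : v ≠ y)
    (hC : ∀ p : HexVertex, hexGraph.Adj v p → p ≠ w₀ → ∀ γ : HexMidEdgeSAW Λ a s(v, p), v ∉ γ.verts →
      γ.winding = -5 * winding [hexMidpoint s(x, w₀), hexCenter w₀, hexMidpoint s(w₀, y)] -
        winding [hexMidpoint s(p, v), hexCenter v, hexMidpoint s(v, w₀)] -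
        winding [hexMidpoint s(v, w₀), hexCenter w₀, hexMidpoint s(w₀, y)])
    (hdom : let xc : ℝ := hexCriticalFugacity
      let α : ℝ := 1 + 2 * hexCriticalFugacity * Real.cos (5 * Real.pi / 24)
      let s : (w p q : HexVertex) → ℝ := fun w p q =>
        ∑ γ : HexMidEdgeSAW Λ a s(v, w), if v ∉ γ.verts then xc ^ γ.length *
          (α - Real.sqrt 3 * xc *
            ∑ δ : HexMidEdgeSAW ((Λ \ γ.verts.toFinset).erase v) s(v, p) s(v, q), xc ^ δ.length) else 0
      (winding [hexMidpoint s(y, w₀), hexCenter w₀, hexMidpoint s(w₀, v)] = Real.pi / 3 →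
          min (s w₀ w₁ w₂) (s w₂ w₀ w₁) ≤ s w₁ w₂ w₀) ∧
        (winding [hexMidpoint s(y, w₀), hexCenter w₀, hexMidpoint s(w₀, v)] = -(Real.pi / 3) →
          min (s w₀ w₁ w₂) (s w₁ w₂ w₀) ≤ s w₂ w₀ w₁)) :
    let x : ℝ := hexCriticalFugacity
    let α : ℝ := 1 + 2 * hexCriticalFugacity * Real.cos (5 * Real.pi / 24)
    let β : ℝ := 1 + 2 * hexCriticalFugacity * Real.cos (11 * Real.pi / 24)
    let ω : ℂ := Complex.exp (2 * Real.pi * Complex.I / 3)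
    let Z : (w p q : HexVertex) → HexMidEdgeSAW Λ a s(v, w) → ℝ :=
      fun w p q (γ : HexMidEdgeSAW Λ a s(v, w)) =>
      ∑ δ : HexMidEdgeSAW ((Λ \ γ.verts.toFinset).erase v) s(v, p) s(v, q), x ^ δ.length
    let B : (w p q : HexVertex) → ℂ := fun w p q =>
      ∑ γ : HexMidEdgeSAW Λ a s(v, w), if v ∉ γ.verts then
        γ.weight x (5 / 8) * ((β + Real.sqrt 3 * x * Z w p q γ : ℝ) : ℂ) else 0
    let S : (w p q : HexVertex) → ℂ := fun w p q =>
      ∑ γ : HexMidEdgeSAW Λ a s(v, w), if v ∉ γ.verts then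
        γ.weight x (5 / 8) * ((α - Real.sqrt 3 * x * Z w p q γ : ℝ) : ℂ) else 0
    ‖B w₀ w₁ w₂ + ω * B w₁ w₂ w₀ + ω ^ 2 * B w₂ w₀ w₁‖ ≤
      19 / 20 * ‖S w₀ w₁ w₂ + S w₁ w₂ w₀ + S w₂ w₀ w₁‖ := by
  dsimp only at hdom ⊢
  -- the turns at `v` from the chirality
  obtain ⟨ε, hε, T01, -, T20, T10, -, -⟩ := stub_localTurns v w₀ w₁ w₂ h₀ h₁ h₂ h₀₁ h₁₂ h₀₂
  have hε1 : ε = 1 := by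
    rcases hε with h | h
    · exact h
    · exfalso
      rw [h] at T01
      have := Real.pi_pos
      linarith [T01.symm.trans hchir]
  subst hε1
  simp only [one_mul] at T20 T10
  -- the turns at `w₀` (neighbours `y, v, x`)
  obtain ⟨ε', hε', Tyv, -, Txy, Tvy, Txv, -⟩ :=
    stub_localTurns w₀ y v x hwy h₀.symm hwx hvy.symm hvx hxy.symm
  -- the rigid classes: ports `w₁, w₂` from `hC`, the source port `w₀` = the one-vertex walk `[w₀]`;
  -- the offset of the class of `w₀` relative to `w₁` is `δ₀ = (3ε' - 1)π/3` as at depth two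
  set W : ℝ := -5 * (ε' * (Real.pi / 3)) + Real.pi / 3 + ε' * (Real.pi / 3) with hWdef
  set δ₀ : ℝ := (3 * ε' - 1) * (Real.pi / 3) with hδ₀
  have hW₁ : ∀ γ : HexMidEdgeSAW Λ a s(v, w₁), v ∉ γ.verts → γ.winding = W := by
    intro γ hγ
    have h := hC w₁ h₁ h₀₁.symm γ hγ
    rw [Txy, T10, Tvy] at h
    rw [h, hWdef]; ring
  have hW₂ : ∀ γ : HexMidEdgeSAW Λ a s(v, w₂), v ∉ γ.verts → γ.winding = W + -(2 * Real.pi / 3) := by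
    intro γ hγ
    have h := hC w₂ h₂ h₀₂.symm γ hγ
    rw [Txy, T20, Tvy] at h
    rw [h, hWdef]; ring
  have hw₀a : w₀ ∈ a := by rw [hax]; exact Sym2.mem_mk_right x w₀
  have hW₀ : ∀ γ : HexMidEdgeSAW Λ a s(v, w₀), v ∉ γ.verts → γ.winding = W + δ₀ := by
    intro γ hγ
    rw [winding_of_verts_eq_singleton γ (verts_eq_of_sealed_source ha hw₀ hw₀a hva γ hγ), hax, Txv,
      hWdef, hδ₀]
    ring
  set x := hexCriticalFugacity with hxc
  set α : ℝ := 1 + 2 * x * Real.cos (5 * Real.pi / 24) with hα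
  set β : ℝ := 1 + 2 * x * Real.cos (11 * Real.pi / 24) with hβ
  set ω : ℂ := Complex.exp (2 * Real.pi * Complex.I / 3) with hω
  have x0 : 0 ≤ x := nfb_xc_pos.le
  have hω1 : ‖ω‖ = 1 := norm_omega
  -- the six sums
  set S0 := ∑ γ : HexMidEdgeSAW Λ a s(v, w₀), if v ∉ γ.verts then γ.weight x (5 / 8) * ((α - Real.sqrt 3 * x *
    ∑ δ : HexMidEdgeSAW ((Λ \ γ.verts.toFinset).erase v) s(v, w₁) s(v, w₂), x ^ δ.length : ℝ) : ℂ) else 0 with hS0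
  set S1 := ∑ γ : HexMidEdgeSAW Λ a s(v, w₁), if v ∉ γ.verts then γ.weight x (5 / 8) * ((α - Real.sqrt 3 * x *
    ∑ δ : HexMidEdgeSAW ((Λ \ γ.verts.toFinset).erase v) s(v, w₂) s(v, w₀), x ^ δ.length : ℝ) : ℂ) else 0 with hS1
  set S2 := ∑ γ : HexMidEdgeSAW Λ a s(v, w₂), if v ∉ γ.verts then γ.weight x (5 / 8) * ((α - Real.sqrt 3 * x *
    ∑ δ : HexMidEdgeSAW ((Λ \ γ.verts.toFinset).erase v) s(v, w₀) s(v, w₁), x ^ δ.length : ℝ) : ℂ) else 0 with hS2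
  set B0 := ∑ γ : HexMidEdgeSAW Λ a s(v, w₀), if v ∉ γ.verts then γ.weight x (5 / 8) * ((β + Real.sqrt 3 * x *
    ∑ δ : HexMidEdgeSAW ((Λ \ γ.verts.toFinset).erase v) s(v, w₁) s(v, w₂), x ^ δ.length : ℝ) : ℂ) else 0 with hB0
  set B1 := ∑ γ : HexMidEdgeSAW Λ a s(v, w₁), if v ∉ γ.verts then γ.weight x (5 / 8) * ((β + Real.sqrt 3 * x *
    ∑ δ : HexMidEdgeSAW ((Λ \ γ.verts.toFinset).erase v) s(v, w₂) s(v, w₀), x ^ δ.length : ℝ) : ℂ) else 0 with hB1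
  set B2 := ∑ γ : HexMidEdgeSAW Λ a s(v, w₂), if v ∉ γ.verts then γ.weight x (5 / 8) * ((β + Real.sqrt 3 * x *
    ∑ δ : HexMidEdgeSAW ((Λ \ γ.verts.toFinset).erase v) s(v, w₀) s(v, w₁), x ^ δ.length : ℝ) : ℂ) else 0 with hB2
  -- the real dressed masses
  set s₀ : ℝ := ∑ γ : HexMidEdgeSAW Λ a s(v, w₀), if v ∉ γ.verts then x ^ γ.length *
    (α - Real.sqrt 3 * x * ∑ δ : HexMidEdgeSAW ((Λ \ γ.verts.toFinset).erase v) s(v, w₁) s(v, w₂), x ^ δ.length) else 0 with hs₀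
  set s₁ : ℝ := ∑ γ : HexMidEdgeSAW Λ a s(v, w₁), if v ∉ γ.verts then x ^ γ.length *
    (α - Real.sqrt 3 * x * ∑ δ : HexMidEdgeSAW ((Λ \ γ.verts.toFinset).erase v) s(v, w₂) s(v, w₀), x ^ δ.length) else 0 with hs₁
  set s₂ : ℝ := ∑ γ : HexMidEdgeSAW Λ a s(v, w₂), if v ∉ γ.verts then x ^ γ.length *
    (α - Real.sqrt 3 * x * ∑ δ : HexMidEdgeSAW ((Λ \ γ.verts.toFinset).erase v) s(v, w₀) s(v, w₁), x ^ δ.length) else 0 with hs₂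
  set b₀ : ℝ := ∑ γ : HexMidEdgeSAW Λ a s(v, w₀), if v ∉ γ.verts then x ^ γ.length *
    (β + Real.sqrt 3 * x * ∑ δ : HexMidEdgeSAW ((Λ \ γ.verts.toFinset).erase v) s(v, w₁) s(v, w₂), x ^ δ.length) else 0 with hb₀
  set b₁ : ℝ := ∑ γ : HexMidEdgeSAW Λ a s(v, w₁), if v ∉ γ.verts then x ^ γ.length *
    (β + Real.sqrt 3 * x * ∑ δ : HexMidEdgeSAW ((Λ \ γ.verts.toFinset).erase v) s(v, w₂) s(v, w₀), x ^ δ.length) else 0 with hb₁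
  set b₂ : ℝ := ∑ γ : HexMidEdgeSAW Λ a s(v, w₂), if v ∉ γ.verts then x ^ γ.length *
    (β + Real.sqrt 3 * x * ∑ δ : HexMidEdgeSAW ((Λ \ γ.verts.toFinset).erase v) s(v, w₀) s(v, w₁), x ^ δ.length) else 0 with hb₂
  -- slit loop bounds (`≤ 1/5`; slit domains are simply connected)
  have loop_bd : ∀ (e p q : HexVertex), hexGraph.Adj v e → hexGraph.Adj v p → hexGraph.Adj v q →
      e ≠ p → e ≠ q → p ≠ q → ∀ γ : HexMidEdgeSAW Λ a s(v, e), v ∉ γ.verts →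
      0 ≤ ∑ δ : HexMidEdgeSAW ((Λ \ γ.verts.toFinset).erase v) s(v, p) s(v, q), x ^ δ.length ∧
      (∑ δ : HexMidEdgeSAW ((Λ \ γ.verts.toFinset).erase v) s(v, p) s(v, q), x ^ δ.length) ≤ 1 / 5 := by
    intro e p q he hp hq hep heq hpq γ hγ
    refine ⟨Finset.sum_nonneg fun δ _ => pow_nonneg x0 _, ?_⟩
    have heγ : e ∈ γ.verts := mem_verts_of_firstArrival hva γ hγ
    have he' : e ∉ Λ \ γ.verts.toFinset := fun h =>
      (Finset.mem_sdiff.1 h).2 (List.mem_toFinset.2 heγ)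
    have hv' : v ∈ Λ \ γ.verts.toFinset :=
      Finset.mem_sdiff.2 ⟨hv, fun h => hγ (List.mem_toFinset.1 h)⟩
    exact hL _ (stub_slitSC Λ hΛ a ha _ γ) e v p q he' hv' he hp hq hep heq hpq
  -- termwise dressing box
  have term_bd : ∀ Zγ : ℝ, 0 ≤ Zγ → Zγ ≤ 1 / 5 →
      0 ≤ α - Real.sqrt 3 * x * Zγ ∧
      3 / 5 * (α - Real.sqrt 3 * x * Zγ) ≤ β + Real.sqrt 3 * x * Zγ ∧
      β + Real.sqrt 3 * x * Zγ ≤ 4 / 5 * (α - Real.sqrt 3 * x * Zγ) := by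
    intro Zγ hZ0 hZc
    obtain ⟨hl, hu, h0⟩ := dressed_box hZ0 hZc
    exact ⟨h0, hl, hu⟩
  -- bounds on the real masses
  have L0 := fun (γ : HexMidEdgeSAW Λ a s(v, w₀)) (hγ : v ∉ γ.verts) =>
    loop_bd w₀ w₁ w₂ h₀ h₁ h₂ h₀₁ h₀₂ h₁₂ γ hγ
  have L1 := fun (γ : HexMidEdgeSAW Λ a s(v, w₁)) (hγ : v ∉ γ.verts) =>
    loop_bd w₁ w₂ w₀ h₁ h₂ h₀ h₁₂ h₀₁.symm h₀₂.symm γ hγ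
  have L2 := fun (γ : HexMidEdgeSAW Λ a s(v, w₂)) (hγ : v ∉ γ.verts) =>
    loop_bd w₂ w₀ w₁ h₂ h₀ h₁ h₀₂.symm h₁₂.symm h₀₁ γ hγ
  have hs0 : 0 ≤ s₀ := sum_ite_pow_mul_nonneg _ x0 _ fun γ hγ => (term_bd _ (L0 γ hγ).1 (L0 γ hγ).2).1
  have hs1 : 0 ≤ s₁ := sum_ite_pow_mul_nonneg _ x0 _ fun γ hγ => (term_bd _ (L1 γ hγ).1 (L1 γ hγ).2).1
  have hs2 : 0 ≤ s₂ := sum_ite_pow_mul_nonneg _ x0 _ fun γ hγ => (term_bd _ (L2 γ hγ).1 (L2 γ hγ).2).1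
  have hb0l : 3 / 5 * s₀ ≤ b₀ := sum_ite_pow_mul_ge _ x0 _ _ fun γ hγ => (term_bd _ (L0 γ hγ).1 (L0 γ hγ).2).2.1
  have hb1l : 3 / 5 * s₁ ≤ b₁ := sum_ite_pow_mul_ge _ x0 _ _ fun γ hγ => (term_bd _ (L1 γ hγ).1 (L1 γ hγ).2).2.1
  have hb2l : 3 / 5 * s₂ ≤ b₂ := sum_ite_pow_mul_ge _ x0 _ _ fun γ hγ => (term_bd _ (L2 γ hγ).1 (L2 γ hγ).2).2.1
  have hb0u : b₀ ≤ 4 / 5 * s₀ := sum_ite_pow_mul_le _ x0 _ _ fun γ hγ => (term_bd _ (L0 γ hγ).1 (L0 γ hγ).2).2.2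
  have hb1u : b₁ ≤ 4 / 5 * s₁ := sum_ite_pow_mul_le _ x0 _ _ fun γ hγ => (term_bd _ (L1 γ hγ).1 (L1 γ hγ).2).2.2
  have hb2u : b₂ ≤ 4 / 5 * s₂ := sum_ite_pow_mul_le _ x0 _ _ fun γ hγ => (term_bd _ (L2 γ hγ).1 (L2 γ hγ).2).2.2
  -- phase factorisations
  have E1S : S1 = Complex.exp (-Complex.I * (5 / 8 : ℝ) * W) * (s₁ : ℂ) :=
    sum_ite_weight_mul_eq _ W x (5 / 8) _ hW₁
  have E1B : B1 = Complex.exp (-Complex.I * (5 / 8 : ℝ) * W) * (b₁ : ℂ) :=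
    sum_ite_weight_mul_eq _ W x (5 / 8) _ hW₁
  have E2S : S2 = Complex.exp (-Complex.I * (5 / 8 : ℝ) * ((W + -(2 * Real.pi / 3) : ℝ) : ℂ)) * (s₂ : ℂ) :=
    sum_ite_weight_mul_eq _ (W + -(2 * Real.pi / 3)) x (5 / 8) _ hW₂
  have E2B : B2 = Complex.exp (-Complex.I * (5 / 8 : ℝ) * ((W + -(2 * Real.pi / 3) : ℝ) : ℂ)) * (b₂ : ℂ) :=
    sum_ite_weight_mul_eq _ (W + -(2 * Real.pi / 3)) x (5 / 8) _ hW₂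
  have E0S : S0 = Complex.exp (-Complex.I * (5 / 8 : ℝ) * ((W + δ₀ : ℝ) : ℂ)) * (s₀ : ℂ) :=
    sum_ite_weight_mul_eq _ (W + δ₀) x (5 / 8) _ hW₀
  have E0B : B0 = Complex.exp (-Complex.I * (5 / 8 : ℝ) * ((W + δ₀ : ℝ) : ℂ)) * (b₀ : ℂ) :=
    sum_ite_weight_mul_eq _ (W + δ₀) x (5 / 8) _ hW₀
  set e : ℂ := Complex.exp (-Complex.I * (5 / 8 : ℝ) * W) with he
  have hen : ‖e‖ = 1 := by
    rw [he, show -Complex.I * (5 / 8 : ℝ) * (W : ℂ) = ((-((5 / 8 : ℝ) * W) : ℝ) : ℂ) * Complex.I by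
      push_cast; ring, Complex.norm_exp_ofReal_mul_I]
  set Q : ℂ := Complex.exp ((5 * Real.pi / 12 : ℝ) * Complex.I) with hQ
  set Qb : ℂ := Complex.exp (-((5 * Real.pi / 12 : ℝ) * Complex.I)) with hQb
  have hQn : ‖Q‖ = 1 := by rw [hQ, Complex.norm_exp_ofReal_mul_I]
  have hQsigma : Complex.exp (Complex.I * (5 / 8 : ℝ) * ((2 * Real.pi / 3 : ℝ) : ℂ)) = Q := by
    rw [hQ]; exact exp_sigma_eq
  rw [E0S, E0B, E1S, E1B, E2S, E2B, exp_sub_phase, hQsigma]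
  rcases hε' with rfl | rfl
  · /- `y → w₀ → v` turns LEFT: `δ₀ = 2π/3`, classes `(w₂, w₁, w₀)` consecutive, middle port `w₁` -/
    have hδ : δ₀ = 2 * Real.pi / 3 := by rw [hδ₀]; ring
    have hdom₁ : min s₀ s₂ ≤ s₁ := hdom.1 (by rw [Tyv]; ring)
    have hph : Complex.exp (-Complex.I * (5 / 8 : ℝ) * ((W + δ₀ : ℝ) : ℂ)) = e * Qb := by
      rw [exp_add_phase, hδ, hQb, exp_neg_sigma_eq]
    rw [hph]
    have eL : e * Qb * (b₀ : ℂ) + ω * (e * (b₁ : ℂ)) + ω ^ 2 * (e * Q * (b₂ : ℂ)) =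
        ω * e * ((b₁ : ℂ) + b₂ * (ω * Q) + b₀ * (ω ^ 2 * Qb)) := by
      have hω3 : ω ^ 3 = 1 := omega_pow_three
      linear_combination (-(e * Qb * (b₀ : ℂ))) * hω3
    have eR : e * Qb * (s₀ : ℂ) + e * (s₁ : ℂ) + e * Q * (s₂ : ℂ) = e * ((s₁ : ℂ) + s₂ * Q + s₀ * Qb) := by ring
    rw [eL, eR]
    simp only [norm_mul, hω1, hen, one_mul]
    rw [hω, hQ, hQb, omega_mul_expQ, omega_sq_mul_exp_neg]
    exact three_class_bound_min' hs1 hs2 hs0 (by rwa [min_comm] at hdom₁) hb1l hb1u hb2l hb2u hb0l hb0u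
  · /- `y → w₀ → v` turns RIGHT: `δ₀ = -4π/3`, classes `(w₀, w₂, w₁)` consecutive, middle port `w₂` -/
    have hδ : δ₀ = -(4 * Real.pi / 3) := by rw [hδ₀]; ring
    have hdom₂ : min s₀ s₁ ≤ s₂ := hdom.2 (by rw [Tyv]; ring)
    have hph : Complex.exp (-Complex.I * (5 / 8 : ℝ) * ((W + δ₀ : ℝ) : ℂ)) = e * Q ^ 2 := by
      rw [exp_add_phase, hδ, hQ, exp_neg_sigma_neg_four_pi_div_three]
    rw [hph]
    have eL : e * Q ^ 2 * (b₀ : ℂ) + ω * (e * (b₁ : ℂ)) + ω ^ 2 * (e * Q * (b₂ : ℂ)) =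
        ω ^ 2 * Q * e * ((b₂ : ℂ) + b₀ * (ω * Q) + b₁ * (ω ^ 2 * Qb)) := by
      have hω3 : ω ^ 3 = 1 := omega_pow_three
      have hQQ : Q * Qb = 1 := by
        rw [hQ, hQb, ← Complex.exp_add, add_neg_cancel, Complex.exp_zero]
      linear_combination (-(e * Q ^ 2 * (b₀ : ℂ)) - e * (b₁ : ℂ) * ω * Q * Qb) * hω3 +
        (-(e * (b₁ : ℂ) * ω)) * hQQ
    have eR : e * Q ^ 2 * (s₀ : ℂ) + e * (s₁ : ℂ) + e * Q * (s₂ : ℂ) =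
        Q * e * ((s₂ : ℂ) + s₀ * Q + s₁ * Qb) := by
      have hQQ : Q * Qb = 1 := by
        rw [hQ, hQb, ← Complex.exp_add, add_neg_cancel, Complex.exp_zero]
      linear_combination (-(e * (s₁ : ℂ))) * hQQ
    rw [eL, eR]
    simp only [norm_mul, norm_pow, hω1, hQn, hen, one_pow, one_mul]
    rw [hω, hQ, hQb, omega_mul_expQ, omega_sq_mul_exp_neg]
    exact three_class_bound_min' hs2 hs0 hs1 hdom₂ hb2l hb2u hb0l hb0u hb1l hb1u

/-! ## All positions of the source vertex -/

/-- **Slit coherence on the source-adjacent stratum, every positive labelling.** Under the quantitative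
slit-loop bound `hL` (`≤ 1/5`), the rigid source-adjacent classes `hC` and middle-port dominance `hdom`
(both stated for the source vertex in first position of a positive labelling, as in `sourceAdj_core`),
the slit-coherence inequality holds with `k = 19/20` at every interior vertex `v` off the source that is
ADJACENT TO THE SOURCE VERTEX (`∃ w ∼ v`, `w ∈ a`), for every positive labelling `(w₀, w₁, w₂)`: the
source vertex is one of `w₀, w₁, w₂` (`adj_cases`) and the three positions are `sourceAdj_core` for the
three cyclic rotations of the labelling, whose Beltrami norms agree (`norm_rotate`). [folklore assembly] -/
theorem sourceAdj_coherence
    (hL : ∀ (Λ : Finset HexVertex), hexDomainSimplyConnected Λ →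
      ∀ u v w₁ w₂ : HexVertex, u ∉ Λ → v ∈ Λ → hexGraph.Adj v u → hexGraph.Adj v w₁ →
        hexGraph.Adj v w₂ → u ≠ w₁ → u ≠ w₂ → w₁ ≠ w₂ →
        (∑ γ : HexMidEdgeSAW (Λ.erase v) s(v, w₁) s(v, w₂), hexCriticalFugacity ^ γ.length) ≤ 1 / 5)
    (hC : ∀ (Λ : Finset HexVertex), hexDomainSimplyConnected Λ → ∀ a ∈ hexDomainBoundary Λ,
      ∀ (v w x y p : HexVertex), v ∈ Λ → v ∉ a → w ∈ Λ → a = s(x, w) → hexGraph.Adj w v →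
      hexGraph.Adj w x → hexGraph.Adj w y → v ≠ x → x ≠ y → v ≠ y → x ∉ Λ →
      hexGraph.Adj v p → p ≠ w → ∀ (γ : HexMidEdgeSAW Λ a s(v, p)), v ∉ γ.verts →
        γ.winding = -5 * winding [hexMidpoint s(x, w), hexCenter w, hexMidpoint s(w, y)] -
          winding [hexMidpoint s(p, v), hexCenter v, hexMidpoint s(v, w)] -
          winding [hexMidpoint s(v, w), hexCenter w, hexMidpoint s(w, y)])
    (hdom : ∀ (Λ : Finset HexVertex), hexDomainSimplyConnected Λ → ∀ a ∈ hexDomainBoundary Λ,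
      ∀ v ∈ Λ, v ∉ a → ∀ w₀ w₁ w₂ x y : HexVertex, hexGraph.Adj v w₀ → hexGraph.Adj v w₁ →
      hexGraph.Adj v w₂ → w₀ ≠ w₁ → w₁ ≠ w₂ → w₀ ≠ w₂ → w₀ ∈ Λ → a = s(x, w₀) →
      winding [hexMidpoint s(w₀, v), hexCenter v, hexMidpoint s(v, w₁)] = Real.pi / 3 →
      hexGraph.Adj w₀ x → hexGraph.Adj w₀ y → v ≠ x → x ≠ y → v ≠ y → x ∉ Λ →
      let xc : ℝ := hexCriticalFugacity
      let α : ℝ := 1 + 2 * hexCriticalFugacity * Real.cos (5 * Real.pi / 24)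
      let s : (w p q : HexVertex) → ℝ := fun w p q =>
        ∑ γ : HexMidEdgeSAW Λ a s(v, w), if v ∉ γ.verts then xc ^ γ.length *
          (α - Real.sqrt 3 * xc *
            ∑ δ : HexMidEdgeSAW ((Λ \ γ.verts.toFinset).erase v) s(v, p) s(v, q), xc ^ δ.length) else 0
      (winding [hexMidpoint s(y, w₀), hexCenter w₀, hexMidpoint s(w₀, v)] = Real.pi / 3 →
          min (s w₀ w₁ w₂) (s w₂ w₀ w₁) ≤ s w₁ w₂ w₀) ∧
        (winding [hexMidpoint s(y, w₀), hexCenter w₀, hexMidpoint s(w₀, v)] = -(Real.pi / 3) →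
          min (s w₀ w₁ w₂) (s w₁ w₂ w₀) ≤ s w₂ w₀ w₁))
    {Λ : Finset HexVertex} (hΛ : hexDomainSimplyConnected Λ) {a : Sym2 HexVertex}
    (ha : a ∈ hexDomainBoundary Λ) {v : HexVertex} (hv : v ∈ Λ) (hva : v ∉ a)
    (hint : ∀ u : HexVertex, hexGraph.Adj v u → u ∈ Λ)
    (hsrc : ∃ w : HexVertex, hexGraph.Adj v w ∧ w ∈ a)
    {w₀ w₁ w₂ : HexVertex} (h₀ : hexGraph.Adj v w₀) (h₁ : hexGraph.Adj v w₁) (h₂ : hexGraph.Adj v w₂)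
    (h₀₁ : w₀ ≠ w₁) (h₁₂ : w₁ ≠ w₂) (h₀₂ : w₀ ≠ w₂)
    (hchir : winding [hexMidpoint s(w₀, v), hexCenter v, hexMidpoint s(v, w₁)] = Real.pi / 3) :
    let x : ℝ := hexCriticalFugacity
    let α : ℝ := 1 + 2 * hexCriticalFugacity * Real.cos (5 * Real.pi / 24)
    let β : ℝ := 1 + 2 * hexCriticalFugacity * Real.cos (11 * Real.pi / 24)
    let ω : ℂ := Complex.exp (2 * Real.pi * Complex.I / 3)
    let Z : (w p q : HexVertex) → HexMidEdgeSAW Λ a s(v, w) → ℝ :=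
      fun w p q (γ : HexMidEdgeSAW Λ a s(v, w)) =>
      ∑ δ : HexMidEdgeSAW ((Λ \ γ.verts.toFinset).erase v) s(v, p) s(v, q), x ^ δ.length
    let B : (w p q : HexVertex) → ℂ := fun w p q =>
      ∑ γ : HexMidEdgeSAW Λ a s(v, w), if v ∉ γ.verts then
        γ.weight x (5 / 8) * ((β + Real.sqrt 3 * x * Z w p q γ : ℝ) : ℂ) else 0
    let S : (w p q : HexVertex) → ℂ := fun w p q =>
      ∑ γ : HexMidEdgeSAW Λ a s(v, w), if v ∉ γ.verts then
        γ.weight x (5 / 8) * ((α - Real.sqrt 3 * x * Z w p q γ : ℝ) : ℂ) else 0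
    ‖B w₀ w₁ w₂ + ω * B w₁ w₂ w₀ + ω ^ 2 * B w₂ w₀ w₁‖ ≤
      19 / 20 * ‖S w₀ w₁ w₂ + S w₁ w₂ w₀ + S w₂ w₀ w₁‖ := by
  dsimp only
  obtain ⟨w, hvw, hwa⟩ := hsrc
  have hwΛ : w ∈ Λ := hint w hvw
  -- the source mid-edge is `{x, w}` with `x ∉ Λ`
  obtain ⟨x, hax, hx, hwx⟩ : ∃ x : HexVertex, a = s(x, w) ∧ x ∉ Λ ∧ hexGraph.Adj w x := by
    obtain ⟨he, u', v', hauv, hv', hu'⟩ := ha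
    have hwv' : w = v' := by
      rw [hauv] at hwa
      rcases Sym2.mem_iff.1 hwa with h' | h'
      · exact absurd (h' ▸ hwΛ) hu'
      · exact h'
    subst hwv'
    refine ⟨u', hauv, hu', ?_⟩
    have hadj : hexGraph.Adj u' w := by
      rw [hauv] at he
      exact (SimpleGraph.mem_edgeSet hexGraph).1 he
    exact hadj.symm
  have hxv : x ≠ v := fun h => hx (h ▸ hv)
  -- the third neighbour of `w`
  obtain ⟨y, hwy, hyv, hyx⟩ : ∃ y : HexVertex, hexGraph.Adj w y ∧ y ≠ v ∧ y ≠ x := by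
    have h3 := card_neighborSet_hexGraph_holds w
    obtain ⟨p, q, r, hpq, hpr, hqr, hS⟩ := Set.ncard_eq_three.1 h3
    have hp : hexGraph.Adj w p := by rw [← SimpleGraph.mem_neighborSet, hS]; simp
    have hq : hexGraph.Adj w q := by rw [← SimpleGraph.mem_neighborSet, hS]; simp
    have hr : hexGraph.Adj w r := by rw [← SimpleGraph.mem_neighborSet, hS]; simp
    by_cases hpv : p = v
    · by_cases hqx : q = x
      · exact ⟨r, hr, fun h => hpr (hpv.trans h.symm), fun h => hqr (hqx.trans h.symm)⟩
      · exact ⟨q, hq, fun h => hpq (hpv.trans h.symm), hqx⟩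
    · by_cases hpx : p = x
      · by_cases hqv : q = v
        · exact ⟨r, hr, fun h => hqr (hqv.trans h.symm), fun h => hpr (hpx.trans h.symm)⟩
        · exact ⟨q, hq, hqv, fun h => hpq (hpx.trans h.symm)⟩
      · exact ⟨p, hp, hpv, hpx⟩
  -- the other two positive chiralities
  obtain ⟨ε, hε, T01, T12, T20, -, -, -⟩ := stub_localTurns v w₀ w₁ w₂ h₀ h₁ h₂ h₀₁ h₁₂ h₀₂
  have hε1 : ε = 1 := by
    rcases hε with h | h
    · exact h
    · exfalso
      rw [h] at T01
      have := Real.pi_pos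
      linarith [T01.symm.trans hchir]
  subst hε1
  simp only [one_mul] at T12 T20
  -- the classes at `v`, pointwise form
  have hCv : ∀ p : HexVertex, hexGraph.Adj v p → p ≠ w → ∀ γ : HexMidEdgeSAW Λ a s(v, p),
      v ∉ γ.verts →
      γ.winding = -5 * winding [hexMidpoint s(x, w), hexCenter w, hexMidpoint s(w, y)] -
        winding [hexMidpoint s(p, v), hexCenter v, hexMidpoint s(v, w)] -
        winding [hexMidpoint s(v, w), hexCenter w, hexMidpoint s(w, y)] :=
    fun p hp hpw γ hγ => hC Λ hΛ a ha v w x y p hv hva hwΛ hax hvw.symm hwx hwy hxv.symm hyx.symm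
      hyv.symm hx hp hpw γ hγ
  rcases adj_cases h₀ h₁ h₂ h₀₁ h₁₂ h₀₂ hvw with rfl | rfl | rfl
  · have hd := hdom Λ hΛ a ha v hv hva w w₁ w₂ x y h₀ h₁ h₂ h₀₁ h₁₂ h₀₂ hwΛ hax hchir hwx hwy hxv.symm
      hyx.symm hyv.symm hx
    have h := sourceAdj_core hL hΛ ha hv hva h₀ h₁ h₂ h₀₁ h₁₂ h₀₂ hwΛ hax hchir hwx hwy hxv.symm
      hyx.symm hyv.symm hCv hd
    dsimp only at h
    exact h
  · have hd := hdom Λ hΛ a ha v hv hva w w₂ w₀ x y h₁ h₂ h₀ h₁₂ h₀₂.symm h₀₁.symm hwΛ hax T12 hwx hwy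
      hxv.symm hyx.symm hyv.symm hx
    have h := sourceAdj_core hL hΛ ha hv hva h₁ h₂ h₀ h₁₂ h₀₂.symm h₀₁.symm hwΛ hax T12 hwx hwy hxv.symm
      hyx.symm hyv.symm hCv hd
    dsimp only at h
    rw [norm_rotate]
    convert h using 3
    ring
  · have hd := hdom Λ hΛ a ha v hv hva w w₀ w₁ x y h₂ h₀ h₁ h₀₂.symm h₀₁ h₁₂.symm hwΛ hax T20 hwx hwy
      hxv.symm hyx.symm hyv.symm hx
    have h := sourceAdj_core hL hΛ ha hv hva h₂ h₀ h₁ h₀₂.symm h₀₁ h₁₂.symm hwΛ hax T20 hwx hwy hxv.symm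
      hyx.symm hyv.symm hCv hd
    dsimp only at h
    rw [norm_rotate, norm_rotate]
    convert h using 3
    ring

end Summit.CriticalPhenomena.SAWScalingLimit.Theorems.SAWDevelopingMapNoFoldBound
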